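import Mathlib
import Literature.Probability.LatticeModels.GKSInequalities
import HarnessLib

/-!
# Crux `PrecisionLaplacian.InverseMFerromagnet` (stmt-CriticalPhenomena-4798), line `Sketch` —
# stub `helper_sp_parallel` (T-SP·2, the parallel-bond step of the series–parallel induction)

THEOREM-ONLY helper file (no definitions).  DB♯ — the dressed edge bound
`(Σ⁻¹)_xy ≤ −t/(1 + t² − 2 t G_xy)` with `t = tanh (total coupling on {x,y})`,
`G_xy = ⟨σ_xσ_y⟩` — is preserved when a PARALLEL copy (index `Fin.last m`, support `C i₀`) of the
bond `i₀` is appended.  Pure bookkeeping: with the merged coupling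
`K i := K' i.castSucc + (if i = i₀ then K' (Fin.last m) else 0)` (`≥ 0`) on the old structure,
the Hamiltonians agree pointwise (`spPar_hamiltonian`), hence so does every `gksExpect`
(`spPar_gksExpect`), and the total couplings on every pair `{x,y}` agree (`spPar_coupling`); the
hypothesis at this `K` is then literally the goal.
-/

namespace Summit.CriticalPhenomena.Ising3DConformalLimit.Cruxes.InverseMFerromagnet.PartialCovarianceLadder

open Literature.Probability.LatticeModels Finset Matrix

noncomputable section

/-- Appending a parallel copy of the bond `i₀` = merging its coupling into `i₀`: the Hamiltonians
agree pointwise. [folklore] -/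
theorem spPar_hamiltonian {n m : ℕ} (C : Fin m → Finset (Fin n)) (i₀ : Fin m)
    (C' : Fin (m + 1) → Finset (Fin n)) (hC : ∀ i : Fin m, C' i.castSucc = C i)
    (hlast : C' (Fin.last m) = C i₀) (K' : Fin (m + 1) → ℝ) (ω : SpinConfig (Fin n)) :
    gksHamiltonian Finset.univ K' C' ω
      = gksHamiltonian Finset.univ
          (fun i => K' i.castSucc + if i = i₀ then K' (Fin.last m) else 0) C ω := by
  simp only [gksHamiltonian]
  rw [Fin.sum_univ_castSucc]
  simp only [hC, hlast, add_mul, Finset.sum_add_distrib, ite_mul, zero_mul, Finset.sum_ite_eq',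
    Finset.mem_univ, if_true]

/-- Hence every expectation of the extended system equals that of the merged old system. [folklore] -/
theorem spPar_gksExpect {n m : ℕ} (C : Fin m → Finset (Fin n)) (i₀ : Fin m)
    (C' : Fin (m + 1) → Finset (Fin n)) (hC : ∀ i : Fin m, C' i.castSucc = C i)
    (hlast : C' (Fin.last m) = C i₀) (K' : Fin (m + 1) → ℝ) (f : SpinConfig (Fin n) → ℝ) :
    gksExpect Finset.univ K' C' f
      = gksExpect Finset.univ
          (fun i => K' i.castSucc + if i = i₀ then K' (Fin.last m) else 0) C f := by
  simp only [gksExpect, gksSum, gksWeight, spPar_hamiltonian C i₀ C' hC hlast K']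

/-- The total coupling on a pair `{x, y}` of the extended system equals that of the merged old
system. [folklore] -/
theorem spPar_coupling {n m : ℕ} (C : Fin m → Finset (Fin n)) (i₀ : Fin m)
    (C' : Fin (m + 1) → Finset (Fin n)) (hC : ∀ i : Fin m, C' i.castSucc = C i)
    (hlast : C' (Fin.last m) = C i₀) (K' : Fin (m + 1) → ℝ) (x y : Fin n) :
    ∑ i ∈ Finset.univ.filter (fun i => C' i = {x, y}), K' i
      = ∑ i ∈ Finset.univ.filter (fun i => C i = {x, y}),
          (K' i.castSucc + if i = i₀ then K' (Fin.last m) else 0) := by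
  rw [Finset.sum_filter, Finset.sum_filter, Fin.sum_univ_castSucc]
  simp only [hC, hlast]
  rw [show (∑ i : Fin m, if C i = {x, y} then K' i.castSucc + (if i = i₀ then K' (Fin.last m) else 0)
        else 0)
      = (∑ i : Fin m, if C i = {x, y} then K' i.castSucc else 0)
        + ∑ i : Fin m, if i = i₀ then (if C i = {x, y} then K' (Fin.last m) else 0) else 0 by
    rw [← Finset.sum_add_distrib]
    refine Finset.sum_congr rfl fun i _ => ?_
    split_ifs <;> ring]
  rw [Finset.sum_ite_eq' Finset.univ i₀, if_pos (Finset.mem_univ _)]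

/-- **T-SP·2 (parallel bond).**  Appending a copy `Fin.last m` of the bond `i₀` preserves DB♯ for all
couplings: the Hamiltonian of `(K', C')` equals that of the old structure with coupling
`K' i₀.castSucc + K' (Fin.last m)` on `i₀` (same `σ_{C i₀}` term), so every `gksExpect` and every
total coupling `∑_{i : C' i = {x,y}} K' i` agree with those of that old system, to which the
hypothesis applies. [folklore] -/
theorem helper_sp_parallel :
    ∀ (n m : ℕ) (C : Fin m → Finset (Fin n)), (∀ i, (C i).card = 2) →
    (∀ (K : Fin m → ℝ), (∀ i, 0 ≤ K i) → ∀ x y : Fin n, x ≠ y →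
        (Matrix.of fun p q : Fin n => gksExpect Finset.univ K C (fun ω => spinAt p ω * spinAt q ω))⁻¹ x y ≤
          -(Real.tanh (∑ i ∈ Finset.univ.filter (fun i => C i = {x, y}), K i)) /
            (1 + Real.tanh (∑ i ∈ Finset.univ.filter (fun i => C i = {x, y}), K i) ^ 2
              - 2 * Real.tanh (∑ i ∈ Finset.univ.filter (fun i => C i = {x, y}), K i)
                * gksExpect Finset.univ K C (fun ω => spinAt x ω * spinAt y ω))) →
    ∀ (i₀ : Fin m) (C' : Fin (m + 1) → Finset (Fin n)),
      (∀ i : Fin m, C' i.castSucc = C i) → C' (Fin.last m) = C i₀ →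
      ∀ (K' : Fin (m + 1) → ℝ), (∀ i, 0 ≤ K' i) → ∀ x y : Fin n, x ≠ y →
        (Matrix.of fun p q : Fin n => gksExpect Finset.univ K' C' (fun ω => spinAt p ω * spinAt q ω))⁻¹ x y ≤
          -(Real.tanh (∑ i ∈ Finset.univ.filter (fun i => C' i = {x, y}), K' i)) /
            (1 + Real.tanh (∑ i ∈ Finset.univ.filter (fun i => C' i = {x, y}), K' i) ^ 2
              - 2 * Real.tanh (∑ i ∈ Finset.univ.filter (fun i => C' i = {x, y}), K' i)
                * gksExpect Finset.univ K' C' (fun ω => spinAt x ω * spinAt y ω)) := by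
  intro n m C _hcard hDB i₀ C' hC hlast K' hK' x y hxy
  have hK : ∀ i, 0 ≤ (fun i => K' i.castSucc + if i = i₀ then K' (Fin.last m) else 0) i := by
    intro i
    dsimp only
    split_ifs
    · exact add_nonneg (hK' _) (hK' _)
    · rw [add_zero]; exact hK' _
  have h := hDB _ hK x y hxy
  simp only [spPar_gksExpect C i₀ C' hC hlast K', spPar_coupling C i₀ C' hC hlast K']
  exact h

end

end Summit.CriticalPhenomena.Ising3DConformalLimit.Cruxes.InverseMFerromagnet.PartialCovarianceLadder
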